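import Summits.CriticalPhenomena.PercolationContinuityZ3.Theorems.Transplant.SkelNeg1ChoiceOW
import Summits.CriticalPhenomena.PercolationContinuityZ3.Theorems.Transplant.KNLevelsTargetLemmaAdditive
import HarnessLib

/-!
# N1 (the {±1} node), THE RE-ORDERED CLOSURE with the ADDITIVE CORRIDOR (NEG-SCOPE §B.19 (Q′-3); design owner p3-g11):
# `samePDropOfSkeletonNeg₁_of_residuesNOWA` — the scheme threshold `δc`, the face accuracy `δ₂` and `K₀` are fixed FIRST and are
# LENGTH-FREE; the corridor residue is `∃ nmax, Skel.ReachOblRHN G nmax … (δC nmax)` for a κ-PROVIDED accuracy function `δC : ℕ → ℝ`,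
# so the (C) column may choose its corridor length AFTER `K₀` (cells may scale with `K`: the invariant [I1] of NEG-SCOPE §B.18 is gone)

builds on p205010 (kernel theorem, internal audit signed; external expert review pending) through `KNLevels.chain_edge_from_source_KN`
(part 7b ← `AdditiveGluing_proof`).  `SamePDropOfSkeletonNeg₁` stays OPEN (conditional assembly); NOTHING of record is touched: the
closure of record `samePDropOfSkeletonNeg₁_of_residuesNOW` / `…_of_choiceFnNOW` (p286999) and the interface `ChoiceNO` (p282003) are
unchanged; this is an ADDITIONAL closure top, proposed for the lead's ruling (NEG-SCOPE §B.19).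
Lane `prim-bschramm`, seat `prim-bschramm-p3` (gen 11; N1 design owner); helper file (`--supports stmt-CriticalPhenomena-4575`).

WHY (§B.19 (b)): in the closure of record ONE number `δ := δCN(nmaxN, 2⁻³⁵)` is the scheme threshold `δc` (KN (30)/(32)), the corridor
kit accuracy AND the input of `apply_step` giving `δ₂`, whence `K₀`; the bundled chain lemma compares the corridor's SOURCE (KN's (32),
confidence `δc`) with the kit accuracy, so the corridor length `nmaxN` had to be fixed before `K₀`.  With the SOURCE-ADDITIVE chain estimate
(`P(reach) ≥ P(source) − (n+1)(Cδ + η)`, part 7b) the source loss `δc` is paid once and the per-round losses are paid by a kit accuracy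
`δC nmax` chosen as a function of the length — so the order becomes `δc := 2⁻³⁷ → δ₂ → K₀`, then `δC n := 2⁻³⁷ / ((n+1)(C+1))`, and the
residues receive `(K₀, δc, δ₂, δr, δC)` with NO bound on the corridor length.
* §0 `KNCells.KSchA.hreach_of_chain_src_sub`, `Skel.reach_of_reachOblAtHN_src`, `Skelφ.kitAtRun_of_oblRHNMW_src` — the corridor
  packaging with the chain hypothesis in SOURCE-SEPARATED shape (source at `S.δc`, kits at `δ`, no `δc ≤ δ`);
* §1 **`PlanarSkeletonNeg.samePDropOfSkeletonNeg₁_of_residuesNOWA`** — the residue-level closure, re-ordered.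
The choice-level packaging (`ConstsA`, `ChoiceFnNOA`, `…_of_choiceFnNOWA`) is the companion file `SkelNeg1ChoiceA`.
[cite: KozmaNitzan2024, §4 Theorem 6 (pp. 25–31), Lemmas 10–12; §1 p. 2 (approach 1)] [cite: MartineauTassion2017, §3.4] [this work]
-/

noncomputable section

open MeasureTheory ProbabilityTheory
open scoped ENNReal Classical

namespace Summit.CriticalPhenomena.PercolationContinuityZ3.Theorems.Transplant

open Literature.Probability.Percolation Literature.Probability.LatticeModels SimpleGraph KNCells KNLevels
open Literature.Barriers.CriticalPhenomena (HasExponentialGrowth)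

/-! ## §0 The corridor packaging with a source-separated chain hypothesis -/

namespace KNCells.KSchA

open GadgetSystem ProbeHistory HSiteScheme Contour

variable {V : Type*} [DecidableEq V] [Countable V] {A : Type*} {G : SimpleGraph V} [G.LocallyFinite] {S : KSchA V A} {FD : FaceData V A}
variable {h : ProbeHistory V} {e : Site 2 × MDir} {a' : A} {du : MDir}

/-- **Lemma 12 over cells with enlarged targets ⟹ `hreach`, SOURCE-SEPARATED form**: as `hreach_of_chain_edge_sub`, but the chain
hypothesis takes the source at the scheme threshold (`1 − S.δc < P(reachB)`, which is exactly KN's (32) under `Wcor`) and the kits at an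
unrelated accuracy `δ` — no `δc ≤ δ`. [cite: KozmaNitzan2024, §4 Lemma 12 (pp. 23–25), p. 30 (Step IV)] [this work] -/
theorem hreach_of_chain_src_sub (G' : SimpleGraph V) [G'.LocallyFinite] (hV : S.Valid₂ G h e) {Δ' : ℕ} {δ ε'' η : ℝ} {n : ℕ}
    (hchain : ∀ (W : Sym2 V → unitInterval) (s : Fin (n + 1) → KNLevels.TStep G') (T' : Fin (n + 1) → Finset V) (η : ℝ),
      (∀ i : Fin (n + 1), (s i).L.o = (s 0).L.o) →
      (∀ i : Fin n, T' (Fin.castSucc i) ⊆ (s i.succ).L.X 0) →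
      (∀ i : Fin (n + 1), T' i ⊆ (s i).T) →
      (∀ i : Fin (n + 1), (s i).KitsAt W S.p Δ' δ) →
      η ≤ δ / 2 →
      (∀ i : Fin (n + 1), (prodBernoulli W).real (⋃ t ∈ (s i).T \ T' i, openConn (s 0).L.o t) ≤ η) →
      1 - S.δc < (prodBernoulli W).real (s 0).L.reachB →
        1 - ε'' < (prodBernoulli W).real (⋃ t ∈ T' (Fin.last n), openConn (s 0).L.o t))
    (s : Fin (n + 1) → KNLevels.TStep G') (T' : Fin (n + 1) → Finset V) (ho : ∀ i : Fin (n + 1), (s i).L.o = S.Γ.root)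
    (hlink : ∀ i : Fin n, T' (Fin.castSucc i) ⊆ (s i.succ).L.X 0) (hsub : ∀ i : Fin (n + 1), T' i ⊆ (s i).T)
    (hkits : ∀ i : Fin (n + 1), (s i).KitsAt (S.Wcor G FD h e (S.aOf₁ G h e) a' du) S.p Δ' δ) (hη : η ≤ δ / 2)
    (hexc : ∀ i : Fin (n + 1), (prodBernoulli (S.Wcor G FD h e (S.aOf₁ G h e) a' du)).real
      (⋃ t ∈ (s i).T \ T' i, openConn S.Γ.root t) ≤ η)
    (hB0 : S.Γ.M (S.aOf₁ G h e) (tgt e) ⊆ (s 0).L.X 0) (hTn : T' (Fin.last n) ⊆ S.Γ.M a' (tgt e + stepVec du)) :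
    1 - ε'' < (prodBernoulli (S.Wfull G h e (S.aOf₁ G h e) a' du)).real (S.Reach G FD h e (S.aOf₁ G h e) a' du) := by
  set α := S.aOf₁ G h e with hα
  have hroot : S.Γ.root ∈ S.Ucor G FD h e α a' du := Finset.mem_union_left _ (Finset.mem_union_left _ hV.root_mem)
  have ho' : ∀ i : Fin (n + 1), (s i).L.o = (s 0).L.o := fun i => by rw [ho i, ho 0]
  have hsrc : 1 - S.δc < (prodBernoulli (S.Wcor G FD h e α a' du)).real (s 0).L.reachB := by
    have := lt_real_reachB_Wcor hV hroot hB0 (a' := a') (du := du)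
    rw [KNLevels.LData.reachB, ho 0]
    exact this
  have hexc' : ∀ i : Fin (n + 1), (prodBernoulli (S.Wcor G FD h e α a' du)).real
      (⋃ t ∈ (s i).T \ T' i, openConn (s 0).L.o t) ≤ η := fun i => by rw [ho 0]; exact hexc i
  have hc := hchain _ s T' η ho' hlink hsub hkits hη hexc' hsrc
  rw [ho 0, Wcor, ← Finset.set_biUnion_coe, prodBernoulli_restrW_real_biUnion_openConn _ _ (Finset.mem_coe.2 hroot)] at hc
  refine hc.trans_le (measureReal_mono ?_ (measure_ne_top _ _))
  rw [Reach, Ucor]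
  exact biUnion_openConnIn_mono subset_rfl _ (Finset.coe_subset.2 hTn)

end KNCells.KSchA

namespace Skel

open GadgetSystem ProbeHistory HSiteScheme Contour

variable {V : Type} [DecidableEq V] [Countable V] {G : SimpleGraph V} [G.LocallyFinite] {A : Type*}
variable {S : KSchA V A} {FD : FaceData V A} {h : ProbeHistory V} {e : Site 2 × MDir} {a' : A} {du : MDir}

/-- **The corridor obligation ⟹ `Reach`, source-separated**: `ReachOblAtHN G nmax … δ` (a chain of `n + 1 ≤ nmax + 1` steps in a habitat
window graph, kits at `δ`, excess `≤ η ≤ δ/2`) and, for every `n ≤ nmax`, the chain property with the source at `S.δc`, the kits at `δ`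
and conclusion `ε''` ⟹ `1 − ε'' < P_μ(Reach)`.  No relation between `δc` and `δ`. [cite: KozmaNitzan2024, §4 p. 30 (Step IV), Lemma 12]
[this work] -/
theorem reach_of_reachOblAtHN_src {nmax : ℕ} (hV : S.Valid₂ G h e) {Δ' : ℕ} {δ ε'' : ℝ}
    (hchain : ∀ n ≤ nmax, ∀ (Ω : Finset V) (Wg : Sym2 V → unitInterval) (s : Fin (n + 1) → KNLevels.TStep (winGraphIn G Ω))
      (T' : Fin (n + 1) → Finset V) (η : ℝ),
      (∀ i : Fin (n + 1), (s i).L.o = (s 0).L.o) →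
      (∀ i : Fin n, T' (Fin.castSucc i) ⊆ (s i.succ).L.X 0) →
      (∀ i : Fin (n + 1), T' i ⊆ (s i).T) →
      (∀ i : Fin (n + 1), (s i).KitsAt Wg S.p Δ' δ) →
      η ≤ δ / 2 →
      (∀ i : Fin (n + 1), (prodBernoulli Wg).real (⋃ t ∈ (s i).T \ T' i, openConn (s 0).L.o t) ≤ η) →
      1 - S.δc < (prodBernoulli Wg).real (s 0).L.reachB →
        1 - ε'' < (prodBernoulli Wg).real (⋃ t ∈ T' (Fin.last n), openConn (s 0).L.o t))
    (hR : ReachOblAtHN G nmax S FD Δ' δ h e a' du) :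
    1 - ε'' < (prodBernoulli (S.Wfull G h e (S.aOf₁ G h e) a' du)).real (S.Reach G FD h e (S.aOf₁ G h e) a' du) := by
  obtain ⟨n, hn, Ω, s, T', η, ho, hlink, hsub, hkits, hη, hexc, hB0, hTn⟩ := hR
  exact KNCells.KSchA.hreach_of_chain_src_sub (winGraphIn G Ω) hV (hchain n hn Ω) s T' ho hlink hsub hkits hη hexc hB0 hTn

end Skel

namespace Skelφ

open GadgetSystem ProbeHistory HSiteScheme Contour
open Skel (winGraph winGraphIn RootOblTW ReachOblRHN)

variable {V : Type} [DecidableEq V] [Countable V] {G : SimpleGraph V} [G.LocallyFinite] {A : Type*}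

/-- **The run-restricted obligations from the residues, root residue law-carrying, corridor chains SOURCE-SEPARATED** (twin of
`kitAtRun_of_oblRHNMW`: the corridor chain property takes the source at `S.δc` and the kits at `δ`, unrelated).
[cite: KozmaNitzan2024, §4 (30), (32), Lemmas 10–12] [this work] -/
theorem kitAtRun_of_oblRHNMW_src {S : KSchA V A} {FD : FaceData V A} {nmax Δ' : ℕ} {δ δ₂ ε'' : ℝ} {δr : ℕ → ℝ}
    (hstep : ∀ (c : V) (Rπ : ℕ) (Wg : Sym2 V → unitInterval) (s : KNLevels.TStep (winGraph G c Rπ)), s.KitsAt Wg S.p Δ' δ₂ →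
      1 - δ₂ < (prodBernoulli Wg).real s.L.reachB → 1 - S.δc / 2 < (prodBernoulli Wg).real (⋃ t ∈ s.T, openConn s.L.o t))
    (hchain : ∀ n ≤ nmax, ∀ (Ω : Finset V) (Wg : Sym2 V → unitInterval) (s : Fin (n + 1) → KNLevels.TStep (winGraphIn G Ω))
      (T' : Fin (n + 1) → Finset V) (η : ℝ),
      (∀ i : Fin (n + 1), (s i).L.o = (s 0).L.o) →
      (∀ i : Fin n, T' (Fin.castSucc i) ⊆ (s i.succ).L.X 0) →
      (∀ i : Fin (n + 1), T' i ⊆ (s i).T) →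
      (∀ i : Fin (n + 1), (s i).KitsAt Wg S.p Δ' δ) →
      η ≤ δ / 2 →
      (∀ i : Fin (n + 1), (prodBernoulli Wg).real (⋃ t ∈ (s i).T \ T' i, openConn (s 0).L.o t) ≤ η) →
      1 - S.δc < (prodBernoulli Wg).real (s 0).L.reachB →
        1 - ε'' < (prodBernoulli Wg).real (⋃ t ∈ T' (Fin.last n), openConn (s 0).L.o t))
    (hchainr : ∀ (n : ℕ) (c : V) (Rπ : ℕ) (Wg : Sym2 V → unitInterval) (s : Fin (n + 1) → KNLevels.TStep (winGraph G c Rπ))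
      (T' : Fin (n + 1) → Finset V) (η : ℝ),
      (∀ i : Fin (n + 1), (s i).L.o = (s 0).L.o) →
      (∀ i : Fin n, T' (Fin.castSucc i) ⊆ (s i.succ).L.X 0) →
      (∀ i : Fin (n + 1), T' i ⊆ (s i).T) →
      (∀ i : Fin (n + 1), (s i).KitsAt Wg S.p Δ' (δr n)) →
      η ≤ δr n / 2 →
      (∀ i : Fin (n + 1), (prodBernoulli Wg).real (⋃ t ∈ (s i).T \ T' i, openConn (s 0).L.o t) ≤ η) →
      1 - δr n < (prodBernoulli Wg).real (s 0).L.reachB →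
        1 - S.δc < (prodBernoulli Wg).real (⋃ t ∈ T' (Fin.last n), openConn (s 0).L.o t))
    (hQ0 : RootOblTW G S Δ' δr) (hface : FaceOblRM G S FD Δ' δ₂) (hreach : ReachOblRHN G nmax S FD Δ' δ) :
    KSchA.KitAtRun G S FD δ₂ ε'' := by
  refine And.intro (Skel.rootObl_of_rootOblTW hchainr hQ0) (And.intro ?_ ?_)
  · intro h e hrun hc hV du hdu j hj o hsrc
    obtain ⟨ψ', hlipψ', hF⟩ := hface h e hrun hc hV du hdu j hj o
    exact cond_of_faceOblAt hlipψ' hstep hF hsrc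
  · intro h e hrun hc hV du hdu
    exact Skel.reach_of_reachOblAtHN_src hV hchain (hreach h e hrun hc hV du hdu)

end Skelφ

/-! ## §1 The residue-level closure, re-ordered -/

namespace PlanarSkeletonNeg

/-- **THE N1 PARTIAL CLOSURE FROM THE THREE RESIDUES, ORIENTED, ROOT LAW-CARRYING, CORRIDOR ADDITIVE, ROOT TABLE FLAT.**  As
`samePDropOfSkeletonNeg₁_of_residuesNOW`, with three differences (NEG-SCOPE §B.19 (Q′-3) and the design owner's (3a) ruling 01:45Z):
(a) the residues receive a FIFTH constant, an accuracy FUNCTION `δC : ℕ → ℝ`, and the corridor residue is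
`∃ nmax, Skel.ReachOblRHN G nmax ⟨Γ, q, δ⟩ FD Φ.Δ (δC nmax)` — ANY corridor length; (b) the root table `δr` handed over is FLAT on
`[0, Lf K₀]` (`δr n = δr 0` there; `Lf` is the caller's length budget as a function of `K₀`), so a kit accuracy read as `min_{m ≤ 1000} δr m`
serves root chains of every length `≤ Lf K₀`; (c) the residues also receive, for the graph at hand, the FACE INNER-CHAIN FACT: chains of
`≤ Lf K₀ + 1` target steps in a window graph `Skel.winGraph G c Rπ` with kits at `δr 0`, excess `≤ δr 0 / 2` and source at `1 − δr 0`
conclude at `1 − δ₂²` (the `hchain` hypothesis of the (F) keystone, verbatim in shape).  Proof: `δ := 2⁻³⁷` (scheme threshold),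
`δ₂ := apply_step(δ/2)`, `K₀` from `(1 − δ₂)^{K₀} < 2⁻³⁵` — all LENGTH-FREE; then from the SOURCE-ADDITIVE chain estimate
`chain_edge_from_source_KN` (constant `C`): `δ0 := min (min_{k ≤ Lf K₀} δ_chain(k)) (δ₂² / (2((Lf K₀ + 1)(C + 1) + 1)))`,
`δr n := δ0` for `n ≤ Lf K₀` and `δ_chain(n)` beyond, `δC n := 2⁻³⁷ / ((n + 1)(C + 1))`; the corridor of `n + 1 ≤ nmax + 1` rounds with
source (32) at `δ` reaches its target with probability `> 1 − δ − 2⁻³⁷ ≥ 1 − 2⁻³⁵`, and the face fact holds because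
`δ0·(1 + (Lf K₀ + 1)(C + ½)) ≤ δ₂²/2`. [cite: KozmaNitzan2024, §4 Theorem 6 (pp. 25–31); §1 p. 2 (approach 1)] [this work] -/
theorem samePDropOfSkeletonNeg₁_of_residuesNOWA (Lf : ℕ → ℕ)
    (hres : ∀ (K₀ : ℕ) (δ δ₂ : ℝ) (δr δC : ℕ → ℝ), 0 < δ → δ ≤ 1 → 0 < δ₂ → δ₂ ≤ 1 → (∀ n, 0 < δr n ∧ δr n ≤ 1) →
      (∀ n, 0 < δC n ∧ δC n ≤ 1) → (∀ n, n ≤ Lf K₀ → δr n = δr 0) →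
      ∀ {V : Type} [DecidableEq V] [Countable V] (G : SimpleGraph V) [G.LocallyFinite] (Φ : PlanarSkeletonNeg G),
        ¬ HasExponentialGrowth G → ∀ t ∈ Φ.types, Φ.types = {t} → ∀ p : unitInterval, 0 < (p : ℝ) → (p : ℝ) < 1 →
          (∀ᵐ ω ∂bondPercolation G p, numInfiniteClusters ω ≤ 1) → ∀ hC : Φ.CylSubcritical p, 0 < theta G t p →
          (∀ n, n ≤ Lf K₀ → ∀ (q' : unitInterval), (q' : ℝ) < 1 →
            ∀ (c : V) (Rπ : ℕ) (Wg : Sym2 V → unitInterval) (s : Fin (n + 1) → KNLevels.TStep (Skel.winGraph G c Rπ))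
              (T' : Fin (n + 1) → Finset V) (η : ℝ),
              (∀ i : Fin (n + 1), (s i).L.o = (s 0).L.o) →
              (∀ i : Fin n, T' (Fin.castSucc i) ⊆ (s i.succ).L.X 0) →
              (∀ i : Fin (n + 1), T' i ⊆ (s i).T) →
              (∀ i : Fin (n + 1), (s i).KitsAt Wg q' Φ.Δ (δr 0)) →
              η ≤ δr 0 / 2 →
              (∀ i : Fin (n + 1), (prodBernoulli Wg).real (⋃ t ∈ (s i).T \ T' i, openConn (s 0).L.o t) ≤ η) →
              1 - δr 0 < (prodBernoulli Wg).real (s 0).L.reachB →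
                1 - δ₂ ^ 2 < (prodBernoulli Wg).real (⋃ t ∈ T' (Fin.last n), openConn (s 0).L.o t)) →
            ∃ (δI : ℝ) (m₀ : ℕ), 0 < δI ∧ δI < 1 ∧
              ∀ O : Skelφ.StepI.OutO V, O.FactsO Φ.frame hC m₀ t →
                ∃ (Sz : Finset ℕ) (SMn : Finset (ℕ × ℕ)), (∀ M ∈ Sz, O.D.M₀ ≤ M) ∧ (∀ q ∈ SMn, O.D.M₀ ≤ q.1 ∧ O.D.n₁ q.1 ≤ q.2) ∧
                  ∀ q : unitInterval, (p : ℝ) / 2 ≤ q → (q : ℝ) ≤ p →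
                    (∀ i ∈ Skelφ.StepI.indexNP {t} Sz SMn,
                      1 - δI < (bondPercolation G q).real (Skelφ.StepI.eventO G Φ.φ O.D O.DT O.ori i)) →
                    Φ.CylSubcritical q →
                      ∃ (A : Type) (Γ : CellGeom V A) (FD : FaceData V A) (LD : LevelData V A),
                        Γ.root = t ∧ K₀ ≤ Γ.K ∧
                        RunGeom G Γ ∧ AnchGeom Γ ∧ SepGeom₂ G Γ ∧ ExitGeom G Γ ∧ StepsGeom Γ FD ∧ LevelGeom G Γ FD LD ∧
                        Skel.RootOblTW G (⟨Γ, q, δ⟩ : KSchA V A) Φ.Δ δr ∧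
                        Skelφ.FaceOblRM G (⟨Γ, q, δ⟩ : KSchA V A) FD Φ.Δ δ₂ ∧
                        ∃ nmax : ℕ, Skel.ReachOblRHN G nmax (⟨Γ, q, δ⟩ : KSchA V A) FD Φ.Δ (δC nmax)) :
    SamePDropOfSkeletonNeg₁ := by
  refine samePDropOfSkeletonNeg₁_of_stepI_runO fun {V} _ _ G _ Φ hg t ht h1 p hp0 hp1 hU hC hθ => ?_
  have hε' : (0 : ℝ) < (1 / 2) ^ 35 := by positivity
  have hΔ : ∀ v, G.degree v ≤ Φ.Δ := Φ.degree_le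
  -- (1) the scheme threshold `δc := 2⁻³⁷`, length-free
  set δ : ℝ := (1 / 2) ^ 37 with hδdef
  have hδ0 : 0 < δ := by positivity
  have hδ1 : δ ≤ 1 := by rw [hδdef]; norm_num
  -- (2) the face accuracy, the TRUE root chain accuracies (bundled lemmas: their sources are certain), then `K₀`
  obtain ⟨δ₂, hδ₂0, hδ₂1, hstep⟩ := SkelConc.apply_step_subgraph_UP G hΔ (half_pos hδ0)
  have hrc := fun n : ℕ => SkelConc.chain_edge_subgraph_UP G hΔ n hδ0
  choose δt hδt0 hδt1 hchaint using hrc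
  obtain ⟨K₀, hK₀⟩ := exists_pow_lt_of_lt_one hε' (show 1 - δ₂ < 1 by linarith)
  -- (3) the SOURCE-ADDITIVE chain estimate; the corridor accuracy as a function of the length
  obtain ⟨C, hC0, hchA⟩ := KNLevels.chain_edge_from_source_KN (V := V) (Δ := Φ.Δ)
  set δC : ℕ → ℝ := fun n => (1 / 2 : ℝ) ^ 37 / ((n + 1 : ℕ) * (C + 1)) with hδCdef
  have hden : ∀ n : ℕ, (0 : ℝ) < (n + 1 : ℕ) * (C + 1) := fun n => by positivity
  have hδC0 : ∀ n, 0 < δC n := fun n => by simp only [hδCdef]; exact div_pos (by positivity) (hden n)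
  have hδC1 : ∀ n, δC n ≤ 1 := fun n => by
    simp only [hδCdef]
    rw [div_le_one (hden n)]
    have h1 : (1 : ℝ) ≤ (n + 1 : ℕ) := by exact_mod_cast Nat.succ_le_succ (Nat.zero_le n)
    have h2 : ((1 / 2 : ℝ) ^ 37) ≤ 1 := by norm_num
    nlinarith
  -- (4) the FLAT root table on `[0, Lf K₀]`: the running minimum of the true accuracies, capped for the face inner-chain fact
  set LF : ℕ := Lf K₀ with hLF
  have hmin : ∀ L : ℕ, ∃ δm : ℝ, 0 < δm ∧ δm ≤ 1 ∧ ∀ k, k ≤ L → δm ≤ δt k := by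
    intro L
    induction L with
    | zero => exact ⟨δt 0, hδt0 0, hδt1 0, fun k hk => by rw [Nat.le_zero.1 hk]⟩
    | succ m ih =>
      obtain ⟨δm, hm0, hm1, hm⟩ := ih
      refine ⟨min δm (δt (m + 1)), lt_min hm0 (hδt0 _), (min_le_left _ _).trans hm1, fun k hk => ?_⟩
      rcases Nat.lt_or_ge k (m + 1) with hlt | hge
      · exact (min_le_left _ _).trans (hm k (by omega))
      · obtain rfl : k = m + 1 := le_antisymm hk hge
        exact min_le_right _ _
  obtain ⟨δm, hδm0, hδm1, hδm⟩ := hmin LF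
  set cap : ℝ := δ₂ ^ 2 / (2 * (((LF + 1 : ℕ) : ℝ) * (C + 1) + 1)) with hcapdef
  have hcapden : (0 : ℝ) < 2 * (((LF + 1 : ℕ) : ℝ) * (C + 1) + 1) := by positivity
  have hcap0 : 0 < cap := div_pos (by positivity) hcapden
  set δ0 : ℝ := min δm cap with hδ0def
  have hδ00 : 0 < δ0 := lt_min hδm0 hcap0
  have hδ01 : δ0 ≤ 1 := (min_le_left _ _).trans hδm1
  have hδ0t : ∀ k, k ≤ LF → δ0 ≤ δt k := fun k hk => (min_le_left _ _).trans (hδm k hk)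
  have hδ0cap : δ0 ≤ cap := min_le_right _ _
  set δr : ℕ → ℝ := fun n => if n ≤ LF then δ0 else δt n with hδrdef
  have hδr_le : ∀ n, δr n ≤ δt n := fun n => by
    simp only [hδrdef]; split_ifs with h
    · exact hδ0t n h
    · exact le_rfl
  have hδr0 : ∀ n, 0 < δr n := fun n => by simp only [hδrdef]; split_ifs <;> [exact hδ00; exact hδt0 n]
  have hδr1 : ∀ n, δr n ≤ 1 := fun n => (hδr_le n).trans (hδt1 n)
  have hflat : ∀ n, n ≤ LF → δr n = δr 0 := fun n hn => by simp only [hδrdef, if_pos hn, if_pos (Nat.zero_le _)]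
  have hδr00 : δr 0 = δ0 := by simp only [hδrdef, if_pos (Nat.zero_le _)]
  -- the root chain property at the flat table (kits are monotone in the accuracy)
  have hchainr : ∀ (n : ℕ) (q : unitInterval), (q : ℝ) < 1 → ∀ (G' : SimpleGraph V) [G'.LocallyFinite], G' ≤ G →
      ∀ (Wt : Sym2 V → unitInterval) (s : Fin (n + 1) → TStep G') (T' : Fin (n + 1) → Finset V) (η : ℝ),
      (∀ i : Fin (n + 1), (s i).L.o = (s 0).L.o) →
      (∀ i : Fin n, T' (Fin.castSucc i) ⊆ (s i.succ).L.X 0) →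
      (∀ i : Fin (n + 1), T' i ⊆ (s i).T) →
      (∀ i : Fin (n + 1), (s i).KitsAt Wt q Φ.Δ (δr n)) →
      η ≤ δr n / 2 →
      (∀ i : Fin (n + 1), (prodBernoulli Wt).real (⋃ t ∈ (s i).T \ T' i, openConn (s 0).L.o t) ≤ η) →
      1 - δr n < (prodBernoulli Wt).real (s 0).L.reachB →
        1 - δ < (prodBernoulli Wt).real (⋃ t ∈ T' (Fin.last n), openConn (s 0).L.o t) := by
    intro n q hq1 G' _ hG' Wt s T' η ho hlink hsub hkits hη hexc hsrc
    exact hchaint n q hq1 G' hG' Wt s T' η ho hlink hsub (fun i => (hkits i).mono (hδr_le n))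
      (hη.trans (by linarith [hδr_le n])) hexc (lt_of_le_of_lt (by linarith [hδr_le n]) hsrc)
  -- the face inner-chain fact at `δr 0 = δ0`
  have hchainF : ∀ n, n ≤ Lf K₀ → ∀ (q' : unitInterval), (q' : ℝ) < 1 →
      ∀ (c : V) (Rπ : ℕ) (Wg : Sym2 V → unitInterval) (s : Fin (n + 1) → KNLevels.TStep (Skel.winGraph G c Rπ))
        (T' : Fin (n + 1) → Finset V) (η : ℝ),
        (∀ i : Fin (n + 1), (s i).L.o = (s 0).L.o) →
        (∀ i : Fin n, T' (Fin.castSucc i) ⊆ (s i.succ).L.X 0) →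
        (∀ i : Fin (n + 1), T' i ⊆ (s i).T) →
        (∀ i : Fin (n + 1), (s i).KitsAt Wg q' Φ.Δ (δr 0)) →
        η ≤ δr 0 / 2 →
        (∀ i : Fin (n + 1), (prodBernoulli Wg).real (⋃ t ∈ (s i).T \ T' i, openConn (s 0).L.o t) ≤ η) →
        1 - δr 0 < (prodBernoulli Wg).real (s 0).L.reachB →
          1 - δ₂ ^ 2 < (prodBernoulli Wg).real (⋃ t ∈ T' (Fin.last n), openConn (s 0).L.o t) := by
    intro n hn q' hq' c Rπ Wg s T' η ho hlink hsub hkits hη hexc hsrc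
    rw [hδr00] at hkits hη hsrc
    have hGc : ∀ x, (Skel.winGraph G c Rπ).degree x ≤ Φ.Δ := SkelConc.degree_le_of_subgraph G hΔ _ (Skel.winGraph_le G c Rπ)
    have hmain := hchA n hδ00 hδ01 δ0 q' hq' (Skel.winGraph G c Rπ) hGc Wg s T' η ho hlink hsub hkits hexc hsrc
    have hη1 : 0 ≤ η := measureReal_nonneg.trans (hexc 0)
    have hn1 : ((n + 1 : ℕ) : ℝ) ≤ (LF + 1 : ℕ) := by rw [hLF]; exact_mod_cast Nat.succ_le_succ hn
    have hkey : δ0 + ((n + 1 : ℕ) : ℝ) * (C * δ0 + η) ≤ δ₂ ^ 2 / 2 := by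
      have h1 : C * δ0 + η ≤ (C + 1) * δ0 := by nlinarith
      have h2 : ((n + 1 : ℕ) : ℝ) * (C * δ0 + η) ≤ ((LF + 1 : ℕ) : ℝ) * ((C + 1) * δ0) :=
        mul_le_mul hn1 h1 (by nlinarith) (by positivity)
      have h3 : δ0 * (2 * (((LF + 1 : ℕ) : ℝ) * (C + 1) + 1)) ≤ δ₂ ^ 2 := by
        have := (le_div_iff₀ hcapden).1 hδ0cap
        linarith
      nlinarith
    have hδ₂sq : (0 : ℝ) < δ₂ ^ 2 := by positivity
    linarith
  -- (5) the residues at these constants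
  obtain ⟨δI, m₀, hδI, hδI1, hS⟩ := hres K₀ δ δ₂ δr δC hδ0 hδ1 hδ₂0 hδ₂1 (fun n => ⟨hδr0 n, hδr1 n⟩) (fun n => ⟨hδC0 n, hδC1 n⟩)
    hflat G Φ hg t ht h1 p hp0 hp1 hU hC hθ hchainF
  refine ⟨δI, m₀, hδI, hδI1, fun D DT ori hk₀ hk₁ hkM hR hΛ e1 e2 e3 e4 e5 hgeom => ?_⟩
  obtain ⟨Sz, SMn, hSz, hSMn, hB⟩ := hS ⟨D, DT, ori⟩ ⟨hk₀, hk₁, hkM, hR, hΛ, e1, e2, e3, e4, e5, hgeom⟩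
  refine ⟨Sz, SMn, hSz, hSMn, fun q hq1 hq2 hcq hCq => ?_⟩
  have hq1' : (q : ℝ) < 1 := lt_of_le_of_lt hq2 hp1
  obtain ⟨A, Γ, FD, LD, hroot, hK, hrun, hanch, hsep, hexit, hsteps, hlev, hrootO, hfaceO, nmax, hreachO⟩ := hB q hq1 hq2 hcq hCq
  refine ⟨A, ⟨Γ, q, δ⟩, FD, LD, (1 / 2) ^ 35, δ₂, hroot, rfl, hrun, hanch, hsep, hexit, hsteps, hlev, hδ1, hε'.le, hδ₂1, ?_, ?_⟩
  · have hKpow : (1 - δ₂) ^ Γ.K ≤ (1 / 2 : ℝ) ^ 35 := (pow_le_pow_of_le_one (by linarith) (by linarith) hK).trans hK₀.le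
    have h32 : (4 : ℝ) * ((1 / 2) ^ 35 + (1 / 2) ^ 35) = (1 / 2) ^ 32 := by norm_num
    show 4 * ((1 - δ₂) ^ Γ.K + (1 / 2 : ℝ) ^ 35) ≤ (1 / 2) ^ 32
    linarith
  · refine Skelφ.kitAtRun_of_oblRHNMW_src (S := ⟨Γ, q, δ⟩)
      (fun c Rπ => hstep q hq1' (Skel.winGraph G c Rπ) (Skel.winGraph_le G c Rπ)) ?_
      (fun n c Rπ => hchainr n q hq1' (Skel.winGraph G c Rπ) (Skel.winGraph_le G c Rπ)) hrootO hfaceO hreachO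
    -- the corridor chains: source at `δc = 2⁻³⁷`, kits at `δC nmax`, `n ≤ nmax` rounds ⟹ conclusion `2⁻³⁵`
    intro n hn Ω Wg s T' η ho hlink hsub hkits hη hexc hsrc
    have hGΩ : ∀ x, (Skel.winGraphIn G Ω).degree x ≤ Φ.Δ := SkelConc.degree_le_of_subgraph G hΔ _ (Skel.winGraphIn_le G Ω)
    have hη1 : 0 ≤ η := measureReal_nonneg.trans (hexc 0)
    have hmain := hchA n (hδC0 nmax) (hδC1 nmax) δ q hq1' (Skel.winGraphIn G Ω) hGΩ Wg s T' η ho hlink hsub hkits hexc hsrc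
    -- arithmetic: `δ + (n+1)(C·δC nmax + η) ≤ 2⁻³⁷ + 2⁻³⁷ ≤ 2⁻³⁵`
    have hn1 : ((n + 1 : ℕ) : ℝ) ≤ (nmax + 1 : ℕ) := by exact_mod_cast Nat.succ_le_succ hn
    have hkey : ((n + 1 : ℕ) : ℝ) * (C * δC nmax + η) ≤ (1 / 2 : ℝ) ^ 37 := by
      have h1 : C * δC nmax + η ≤ (C + 1) * δC nmax := by nlinarith [hδC0 nmax]
      have h2 : ((n + 1 : ℕ) : ℝ) * (C * δC nmax + η) ≤ ((nmax + 1 : ℕ) : ℝ) * ((C + 1) * δC nmax) :=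
        mul_le_mul hn1 h1 (by nlinarith [hδC0 nmax]) (by positivity)
      have h3 : ((nmax + 1 : ℕ) : ℝ) * ((C + 1) * δC nmax) = (1 / 2 : ℝ) ^ 37 := by
        have hd : ((nmax + 1 : ℕ) : ℝ) * (C + 1) ≠ 0 := ne_of_gt (hden nmax)
        simp only [hδCdef]
        rw [← mul_assoc, mul_div_cancel₀ _ hd]
      linarith
    have h35 : (1 / 2 : ℝ) ^ 37 + (1 / 2) ^ 37 ≤ (1 / 2) ^ 35 := by norm_num
    have hb : δ + ((n + 1 : ℕ) : ℝ) * (C * δC nmax + η) ≤ (1 / 2 : ℝ) ^ 35 := by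
      have hδeq : δ = (1 / 2 : ℝ) ^ 37 := hδdef
      rw [hδeq]; linarith
    exact lt_of_le_of_lt (by linarith) hmain

end PlanarSkeletonNeg

end Summit.CriticalPhenomena.PercolationContinuityZ3.Theorems.Transplant

end
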